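import Literature.NumberTheory.EllipticCurves.TorsionConductorExponentAdditiveProofs
import Literature.NumberTheory.EllipticCurves.TamagawaRingEquivProofs
import Literature.NumberTheory.DiophantineGeometry.TateAlgorithmRingEquivProofs
import Summits.BirchSwinnertonDyer.Rank1Residual.GaloisImage.InertiaDivisibleAdditive
import Summits.BirchSwinnertonDyer.Rank1Residual.AdditivePotMult.QuadraticBaseChangeOddTamagawaAdditiveOddPrime
import HarnessLib

/-!
# Crux `KobayashiLowerHalfLargeImage` (item stmt-BirchSwinnertonDyer-19001), line `shadow_seed`:
# the Serre conductor exponent of `E[p]` at an additive place `v ∤ 6p` by Kodaira type —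
# `a_v(E[p]) = f_v(E) = 2` when `p ∤ #Φ_v(k̄)`, and the shadow-prime DROP `a_v(E[3]) = 1` over `ℚ`

HONEST FRAMING (D-0152). Route K3 = `SignedLowerHalves` is a CLASS route; crux 3
(`Theses.SignedLowerHalves.KobayashiLowerHalfLargeImage`) is the Eisenstein half of Kobayashi's signed
main conjecture on the large-image corner of X7. NOTHING here proves the crux, the route, or BSD. This
file is a HELPER of item 19001 (`--supports`): it completes, Summits-side, the kernel computation of the
Serre conductor exponent `a_v(E[p])` (item G09 `GaloisRep.artinConductorExponent` — the exponents of
`ModPGaloisRep.serreLevel`) of the `p`-torsion at the ADDITIVE places `v ∤ 6p`, begun in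
`Literature/NumberTheory/EllipticCurves/TorsionConductorExponentAdditiveProofs.lean` (w2 g8, p661969:
`a_v(E[3]) = 1` when `3 ∣ c_v`; `a_v(E[p]) = 2` for `p ≥ 5`), using the b2b tool
`GaloisImage.InertiaDivisible.localPoints_eq_zero_of_absInertia_fixed_of_not_dvd_componentGroupOrder`
(Summits-side, hence this file lives under `Theorems/`):

* §1 `fixedSubmodule_inertia_primeBelow_torsion_eq_bot_of_not_dvd_componentGroupOrder`,
  `codimFixed_inertia_torsion_eq_two_of_not_dvd_componentGroupOrder`,
  `artinConductorExponent_torsion_eq_two_of_not_dvd_componentGroupOrder`,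
  **`artinConductorExponent_torsion_eq_conductorExponent_of_not_dvd_componentGroupOrder`** — for ANY
  prime `p` and an additive place `v ∤ 6p` whose Kodaira type has `p ∤ #Φ_v(k̄)`
  (`KodairaSymbol.componentGroupOrder`): `E[p]^{I_𝔓} = 0`, `a_v(E[p]) = 2 = f_v(E)` — the exponent is
  KEPT.  At `p = 3` this is every additive type other than `IV`, `IV*` (the tree's
  `AdditivePotMult.KodairaSymbol.three_dvd_componentGroupOrder_iff_of_isAdditive`;
  `artinConductorExponent_torsion_three_eq_conductorExponent_of_ne_IV`): the Galois-side content of the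
  Kodaira clause of the tree's named fact `ribet1990_levelLowering_gamma0_newform_at_three_general`
  («`3 ∤ #Φ_v(𝔽̄_v)` at every additive place keeps the additive part of the conductor»).
* §2 the `p = 3` TABLE at an additive `v ∤ 6`: type `≠ IV, IV*` ⇒ `a_v = 2`; type `IV`/`IV*` with
  `3 ∣ c_v` ⇒ `a_v = 1` (p661969). The remaining cell — `IV`/`IV*` with `c_v = 1` (Frobenius acts by
  `−1` on `Φ_v(k̄) ≅ ℤ/3`; also `a_v = 1` in print, DDT Lemma 2.7) — is NOT treated: it needs the
  component group over `K_v^{nr}`, not only the rational index `c_v` (said, not hidden).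
* §3 over `ℚ`, keyed on the `ℚ_q`/`ℤ_q` data of the line's `ShadowSeed.IsShadowPrimeAt`
  (`kodairaSymbol ℤ_[q] ∈ {IV, IV*}`, `localTamagawaNumber ℤ_[q]`): for a prime `q ≥ 5` with Kodaira
  type `IV`/`IV*` and `3 ∣ c_q`, at the place `v` of `𝓞 ℚ` over `q`:
  **`Rat.artinConductorExponent_torsion_three_eq_one_of_kodairaSymbol_padic` (`a_v(E[3]) = 1`, i.e.
  `q ∥ N(ρ̄_{E,3})`)** and `Rat.conductorExponent_eq_two_of_kodairaSymbol_padic` (`f_q(E) = 2`, i.e.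
  `q² ∥ N_E`) — the level clause that makes Diamond's level-lowered newform Steinberg at `q` in the
  composite binder `ShadowSeed.ShadowSeedTransport_OPEN`; and the `p ≥ 5` no-drop over `ℚ`
  (`Rat.artinConductorExponent_torsion_eq_two_of_isAdditive_padic`).

Dictionary ℚ_q ↔ `v.adicCompletion ℚ`: `kodairaSymbolAt_eq_padic` (`TateAlgorithmRingEquivProofs`),
`localTamagawaNumber_padic_eq_holds` (`TamagawaRingEquivProofs`), Mathlib `Rat.HeightOneSpectrum`.
Nothing is asserted about any particular curve; no modular form enters; BSD is not proved by any of this.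

References: [SilvermanATAEC1994] §IV.10, Thm. IV.10.2, Cor. IV.9.2(d), Table 4.1; [SilvermanAEC2009]
Thm. VII.6.1; [SerreLocalFields1979] Ch. VI §§2–3; [Serre1987] §1.2; [DarmonDiamondTaylor1995] §2.1,
Lemma 2.7; [GreenbergLNM1716] §3 p. 88.
-/

set_option linter.dupNamespace false

noncomputable section

open scoped Classical NumberField Pointwise
open Field IsDedekindDomain IsDedekindDomain.HeightOneSpectrum NumberField

attribute [local instance] AddSubgroup.torsionBy.zmodModule

universe u

namespace Summit.BirchSwinnertonDyer.BirchSwinnertonDyer.Theorems.ShadowConductor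

open Literature.NumberTheory.EllipticCurves Literature.NumberTheory.GaloisRepresentations
  Literature.NumberTheory.DiophantineGeometry WeierstrassCurve
  Summit.BirchSwinnertonDyer.Rank1Residual.GaloisImage Summit.BirchSwinnertonDyer.Rank1Residual

variable {K : Type u} [Field K] [NumberField K] (W : WeierstrassCurve K) {v : HeightOneSpectrum (𝓞 K)}

/-! ### §1. `p ∤ #Φ_v(k̄)`: `E[p]^{I_v} = 0` and `a_v(E[p]) = 2 = f_v(E)` -/

/-- **`E[p]^{I_𝔓} = 0` at an additive `v ∤ p` with `p ∤ #Φ_v(k̄)`** (for the prime `𝔓 = 𝔓_{ι₀,𝔐}` cut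
out by the chosen embedding `K̄ → K̄_v`): a `p`-torsion point of `E(K̄)` fixed by the global inertia group
`I_𝔓` is fixed by the local inertia group `absInertia K_v` (`mem_fixedSubmodule_inertia_primeBelow_iff`,
`inertia_eq_absInertia`), so its image in `E(K̄_v)` is an inertia-fixed `p`-torsion point, which is `O`
because the Kodaira–Néron exponent `[E(K_v^nr) : E₀(K_v^nr)]` is prime to `p` and `E₀(K_v^nr)` has no
`p`-torsion at a cusp (`GaloisImage.InertiaDivisible.localPoints_eq_zero_of_absInertia_fixed_of_not_dvd_componentGroupOrder`).
[cite: SilvermanAEC2009, Thm. VII.6.1 (PDF p. 177)] [cite: SilvermanATAEC1994, Cor. IV.9.2(d) with Table 4.1 (PDF pp. 340, 365)]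
[cite: GreenbergLNM1716, §3 p. 88] -/
theorem fixedSubmodule_inertia_primeBelow_torsion_eq_bot_of_not_dvd_componentGroupOrder
    [W.IsElliptic] (hadd : W.HasAdditiveReductionAt v) {p : ℕ} [Fact p.Prime]
    (hpv : (p : 𝓞 K) ∉ v.asIdeal) (hps : ¬ p ∣ (W.kodairaSymbolAt v).componentGroupOrder)
    {𝔐 : Ideal (localAbsIntegers v)} (h𝔐 : 𝔐 ∈ v.localPrimesAbove) :
    (W.torsionGaloisRep p).fixedSubmodule
        ((v.primeBelow (closureEmb (K := K) (v.adicCompletion K)) 𝔐).inertia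
          (absoluteGaloisGroup K)) = ⊥ := by
  obtain ⟨w, hw⟩ := v.exists_spectralValuation
  have hIeq : 𝔐.inertia (absoluteGaloisGroup (v.adicCompletion K)) =
      absInertia (v.adicCompletion K) := inertia_eq_absInertia hw h𝔐
  rw [eq_bot_iff]
  intro P hP
  rw [Submodule.mem_bot]
  have hfix := (W.mem_fixedSubmodule_inertia_primeBelow_iff h𝔐 P).mp hP
  set ι₀ := closureEmb (K := K) (v.adicCompletion K) with hι₀
  set R : localPoints W (v.adicCompletion K) := pointsMapOfEmb W ι₀ (P : geomPoints W) with hR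
  have hRfix : ∀ τ ∈ absInertia (v.adicCompletion K), τ • R = R := by
    intro τ hτ
    have hτ' : τ ∈ 𝔐.inertia (absoluteGaloisGroup (v.adicCompletion K)) := by rwa [hIeq]
    rw [hR, ← pointsMapOfEmb_smul]
    exact congrArg (pointsMapOfEmb W ι₀) (hfix τ hτ')
  have hpP : p • (P : geomPoints W) = 0 := by
    have h' := (mem_geomTorsion_iff W (p : ℤ) (P : geomPoints W)).mp P.2
    rwa [natCast_zsmul] at h'
  have hpR : p ^ 1 • R = 0 := by rw [pow_one, hR, ← map_nsmul, hpP, map_zero]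
  have hR0 : R = 0 :=
    InertiaDivisible.localPoints_eq_zero_of_absInertia_fixed_of_not_dvd_componentGroupOrder W
      hpv hadd hps R hRfix 1 hpR
  have hP0 : (P : geomPoints W) = 0 := by
    apply pointsMapOfEmb_injective W ι₀
    rw [map_zero, ← hR, hR0]
  exact Subtype.ext hP0

/-- **`codim E[p]^{I_𝔓} = 2` at EVERY prime `𝔓 ∣ v`** of an additive `v ∤ p` with `p ∤ #Φ_v(k̄)`:
`dim E[p] = 2` (`finrank_geomTorsion_eq_two`), `E[p]^{I_𝔓} = 0` at `𝔓_{ι₀,𝔐}`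
(`fixedSubmodule_inertia_primeBelow_torsion_eq_bot_of_not_dvd_componentGroupOrder`) and the codimension
is the same at the conjugate primes (`exists_smul_eq_of_mem_primesAbove_holds`, `Ideal.inertia_smul`,
`ContinuousRep.codimFixed_conj_smul`).  Silverman's `ε_v = 2` read on the `p`-torsion.
[cite: SilvermanATAEC1994, §IV.10 Definition of ε and Thm. IV.10.2 (PDF p. 358)]
[cite: SerreLocalFields1979, Ch. VI §2 Cor. 1' and §3 (globalisation)] -/
theorem codimFixed_inertia_torsion_eq_two_of_not_dvd_componentGroupOrder [W.IsElliptic]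
    (hadd : W.HasAdditiveReductionAt v) {p : ℕ} [Fact p.Prime] (hpv : (p : 𝓞 K) ∉ v.asIdeal)
    (hps : ¬ p ∣ (W.kodairaSymbolAt v).componentGroupOrder)
    {𝔓 : Ideal (absIntegers (𝓞 K) K)} (h𝔓 : 𝔓 ∈ v.primesAbove) :
    (W.torsionGaloisRep p).codimFixed (𝔓.inertia (absoluteGaloisGroup K)) = 2 := by
  have hp : p.Prime := Fact.out
  obtain ⟨𝔐, h𝔐⟩ := v.localPrimesAbove_nonempty
  have h𝔓₁ : v.primeBelow (closureEmb (K := K) (v.adicCompletion K)) 𝔐 ∈ v.primesAbove :=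
    primeBelow_mem_primesAbove h𝔐
  obtain ⟨g, hg⟩ := HeightOneSpectrum.exists_smul_eq_of_mem_primesAbove_holds h𝔓₁ h𝔓
  rw [← hg, Ideal.inertia_smul, ContinuousRep.codimFixed_conj_smul]
  haveI : Finite (geomTorsion W ((p : ℕ) : ℤ)) := W.finite_geomTorsion_nat hp.ne_zero
  haveI : Module.Finite (ZMod p) (geomTorsion W ((p : ℕ) : ℤ)) := Module.Finite.of_finite
  have h2 : Module.finrank (ZMod p) (geomTorsion W ((p : ℕ) : ℤ)) = 2 :=
    W.finrank_geomTorsion_eq_two p (by exact_mod_cast hp.ne_zero)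
  have h0 := fixedSubmodule_inertia_primeBelow_torsion_eq_bot_of_not_dvd_componentGroupOrder W hadd
    hpv hps h𝔐
  have h := ContinuousRep.codimFixed_eq_finrank_sub (W.torsionGaloisRep p)
    ((v.primeBelow (closureEmb (K := K) (v.adicCompletion K)) 𝔐).inertia (absoluteGaloisGroup K))
  rw [h2] at h
  rw [h]
  change 2 - Module.finrank (ZMod p) ((W.torsionGaloisRep p).fixedSubmodule _) = 2
  rw [h0, finrank_bot, Nat.sub_zero]

/-- **`a_𝔓(E[p]) = 2` at an additive `v ∤ p` with `p ∤ #Φ_v(k̄)`, granted tameness of `E[p]` at `𝔓`**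
(`a_𝔓 = codim + Sw = 2 + 0`). [cite: SerreLocalFields1979, Ch. VI §2, Cor. 1'] [cite: Serre1987, §1.2 (definition of N(ρ))] -/
theorem artinConductorAt_torsion_eq_two_of_isTameAt_of_not_dvd_componentGroupOrder [W.IsElliptic]
    (hadd : W.HasAdditiveReductionAt v) {p : ℕ} [Fact p.Prime] (hpv : (p : 𝓞 K) ∉ v.asIdeal)
    (hps : ¬ p ∣ (W.kodairaSymbolAt v).componentGroupOrder)
    {𝔓 : Ideal (absIntegers (𝓞 K) K)} (h𝔓 : 𝔓 ∈ v.primesAbove)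
    (htame : (W.torsionGaloisRep p).IsTameAt (𝓞 K) 𝔓) :
    (W.torsionGaloisRep p).artinConductorAt (𝓞 K) 𝔓 = 2 := by
  rw [GaloisRep.artinConductorAt_def, htame.swanConductorAt_eq_zero, add_zero,
    codimFixed_inertia_torsion_eq_two_of_not_dvd_componentGroupOrder W hadd hpv hps h𝔓, Nat.cast_ofNat]

/-- **`a_v(E[p]) = 2` at every additive place `v ∤ 6p` with `p ∤ #Φ_v(k̄)`**, unconditionally (tameness
of `E[p]` at `v ∤ 6p`: `isTameAt_torsionGaloisRep_of_notMem_two_three`; independence of the prime above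
`v`: `GaloisRep.artinConductorAt_eq_of_mem_primesAbove_holds`).
[cite: SerreLocalFields1979, Ch. VI §§2–3] [cite: Serre1987, §1.2 (definition of N(ρ))]
[cite: SilvermanATAEC1994, Thm. IV.10.2(b) (PDF pp. 358–362)] -/
theorem artinConductorExponent_torsion_eq_two_of_not_dvd_componentGroupOrder [W.IsElliptic]
    (hadd : W.HasAdditiveReductionAt v) {p : ℕ} [Fact p.Prime] (hpv : (p : 𝓞 K) ∉ v.asIdeal)
    (hps : ¬ p ∣ (W.kodairaSymbolAt v).componentGroupOrder)
    (h2 : (2 : 𝓞 K) ∉ v.asIdeal) (h3 : (3 : 𝓞 K) ∉ v.asIdeal) :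
    (W.torsionGaloisRep p).artinConductorExponent v = 2 := by
  obtain ⟨𝔓, h𝔓⟩ := primesAbove_nonempty v
  have h0 := (primesAbove_nonempty v).some_mem
  have htame := W.isTameAt_torsionGaloisRep_of_notMem_two_three p hpv h2 h3 h𝔓
  unfold GaloisRep.artinConductorExponent
  rw [GaloisRep.artinConductorAt_eq_of_mem_primesAbove_holds h0 h𝔓 (W.torsionGaloisRep p),
    artinConductorAt_torsion_eq_two_of_isTameAt_of_not_dvd_componentGroupOrder W hadd hpv hps h𝔓 htame]
  exact Nat.floor_ofNat 2

/-- **The exponent is KEPT: `a_v(E[p]) = f_v(E)` at every additive place `v ∤ 6p` with `p ∤ #Φ_v(k̄)`**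
(`a_v(E[p]) = 2`, `artinConductorExponent_torsion_eq_two_of_not_dvd_componentGroupOrder`; `f_v(E) = ε_v
= 2`, `conductorExponent_eq_tameConductorExponent_holds`, `KodairaSymbol.tameConductorExponent_eq_two_iff`,
`isAdditive_kodairaSymbolAt_iff_holds`).  For every prime `p`: the prime-to-`p` Serre level of `ρ̄_{E,p}`
carries the additive prime `v ∤ 6p` with its full exponent unless `p ∣ #Φ_v(k̄)` — Darmon–Diamond–Taylor's
recipe `m_v(ρ̄) = f_v(E) − dim E[p]^{I_v}` with `E[p]^{I_v} ≅ Φ_v(k̄)[p] = 0`.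
[cite: SilvermanATAEC1994, Thm. IV.10.2 and IV.10.4 (PDF pp. 358–362)] [cite: Serre1987, §1.2 (definition of N(ρ))]
[cite: DarmonDiamondTaylor1995, §2.1 (p. 54) and Lemma 2.7] -/
theorem artinConductorExponent_torsion_eq_conductorExponent_of_not_dvd_componentGroupOrder
    [W.IsElliptic] (hadd : W.HasAdditiveReductionAt v) {p : ℕ} [Fact p.Prime]
    (hpv : (p : 𝓞 K) ∉ v.asIdeal) (hps : ¬ p ∣ (W.kodairaSymbolAt v).componentGroupOrder)
    (h2 : (2 : 𝓞 K) ∉ v.asIdeal) (h3 : (3 : 𝓞 K) ∉ v.asIdeal) :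
    (W.torsionGaloisRep p).artinConductorExponent v = W.conductorExponent v := by
  haveI : PerfectField (IsLocalRing.ResidueField (v.adicCompletionIntegers K)) :=
    PerfectField.ofFinite
  rw [artinConductorExponent_torsion_eq_two_of_not_dvd_componentGroupOrder W hadd hpv hps h2 h3,
    conductorExponent_eq_tameConductorExponent_holds v W
      (v.ringChar_ne_of_natCast_notMem (p := 2) (by exact_mod_cast h2))
      (v.ringChar_ne_of_natCast_notMem (p := 3) (by exact_mod_cast h3)),
    (KodairaSymbol.tameConductorExponent_eq_two_iff _).mpr
      ((isAdditive_kodairaSymbolAt_iff_holds v W).mpr hadd)]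

/-! ### §2. The `p = 3` table at an additive `v ∤ 6` -/

/-- **`p = 3`, type `≠ IV, IV*`: the exponent is kept, `a_v(E[3]) = f_v(E) = 2`** at an additive
`v ∤ 6` whose Kodaira type is not `IV`, `IV*` (then `3 ∤ #Φ_v(k̄) ∈ {1, 2, 4}`,
`AdditivePotMult.KodairaSymbol.three_dvd_componentGroupOrder_iff_of_isAdditive`).  Together with
`WeierstrassCurve.artinConductorExponent_torsion_three_add_one_eq_conductorExponent` (type `IV`/`IV*`
with `3 ∣ c_v`: `a_v(E[3]) = f_v(E) − 1 = 1`) this is the Galois side of the two Kodaira clauses of the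
tree's level-lowering facts `ribet1990_levelLowering_gamma0_newform_at_three_general` /
`…_additiveDrop`; the cell `IV`/`IV*` with `c_v = 1` is not treated here.
[cite: DarmonDiamondTaylor1995, §2.1 (p. 54), Lemma 2.7 and Remark 2.14]
[cite: SilvermanATAEC1994, Table 4.1 (PDF p. 365) and Thm. IV.10.2] -/
theorem artinConductorExponent_torsion_three_eq_conductorExponent_of_ne_IV [W.IsElliptic]
    (hadd : W.HasAdditiveReductionAt v) (h2 : (2 : 𝓞 K) ∉ v.asIdeal) (h3 : (3 : 𝓞 K) ∉ v.asIdeal)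
    (hIV : W.kodairaSymbolAt v ≠ .IV) (hIVs : W.kodairaSymbolAt v ≠ .IVstar) :
    (W.torsionGaloisRep 3).artinConductorExponent v = W.conductorExponent v := by
  haveI : Fact (Nat.Prime 3) := ⟨Nat.prime_three⟩
  haveI : PerfectField (IsLocalRing.ResidueField (v.adicCompletionIntegers K)) :=
    PerfectField.ofFinite
  have hk : (W.kodairaSymbolAt v).IsAdditive := (isAdditive_kodairaSymbolAt_iff_holds v W).mpr hadd
  have hps : ¬ 3 ∣ (W.kodairaSymbolAt v).componentGroupOrder := fun h ↦ by
    rcases (AdditivePotMult.KodairaSymbol.three_dvd_componentGroupOrder_iff_of_isAdditive hk).mp h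
      with h' | h'
    · exact hIV h'
    · exact hIVs h'
  exact artinConductorExponent_torsion_eq_conductorExponent_of_not_dvd_componentGroupOrder W hadd
    (by exact_mod_cast h3) hps h2 h3

/-- **`p = 3`, type `IV`/`IV*` with `3 ∣ c_v`: the exponent DROPS, `a_v(E[3]) = 1 = f_v(E) − 1`** at an
additive `v ∤ 6` (restatement of p661969's `artinConductorExponent_torsion_three_eq_one` /
`…_add_one_eq_conductorExponent` in this file's table form; the Kodaira hypothesis is implied by
`3 ∣ c_v` and is not used). [cite: DarmonDiamondTaylor1995, Lemma 2.7 and Remark 2.14]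
[cite: SilvermanATAEC1994, Table 4.1 (PDF p. 365) and Thm. IV.10.2] -/
theorem artinConductorExponent_torsion_three_eq_one_and_conductorExponent_eq_two [W.IsElliptic]
    (hadd : W.HasAdditiveReductionAt v) (h2 : (2 : 𝓞 K) ∉ v.asIdeal) (h3 : (3 : 𝓞 K) ∉ v.asIdeal)
    (hdvd : 3 ∣ (W.baseChange (v.adicCompletion K)).localTamagawaNumber
      (v.adicCompletionIntegers K)) :
    (W.torsionGaloisRep 3).artinConductorExponent v = 1 ∧ W.conductorExponent v = 2 := by
  have h1 := W.artinConductorExponent_torsion_three_eq_one hadd h2 h3 hdvd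
  have h12 := W.artinConductorExponent_torsion_three_add_one_eq_conductorExponent hadd h2 h3 hdvd
  refine ⟨h1, ?_⟩
  rw [h1] at h12
  exact h12.symm

/-! ### §3. Over `ℚ`: the shadow primes of line `shadow_seed` -/

section Rat

open Rat.HeightOneSpectrum

variable (E : WeierstrassCurve ℚ) [E.IsElliptic] (v : HeightOneSpectrum (𝓞 ℚ))

/-- `p ∉ v` for a prime `p` different from the residue characteristic `ℓ_v = primesEquiv v` of the
finite place `v` of `ℚ` (Mathlib `Rat.HeightOneSpectrum.natGenerator_dvd_iff`); private plumbing.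
[folklore] -/
private theorem natCast_notMem_of_primesEquiv_ne {p : ℕ} (hp : p.Prime)
    (hv : ((primesEquiv v : Nat.Primes) : ℕ) ≠ p) : ((p : ℕ) : 𝓞 ℚ) ∉ v.asIdeal := by
  intro hmem
  apply hv
  change natGenerator v = p
  rw [← Nat.prime_dvd_prime_iff_eq (prime_natGenerator v) hp, natGenerator_dvd_iff,
    ← map_natCast (Rat.IsIntegralClosure.intEquiv (𝓞 ℚ)) p]
  exact Ideal.mem_map_of_mem _ hmem

/-- **`f_q(E) = 2` (`q² ∥ N_E`) at a place of `ℚ` over a prime `q ≥ 5` of Kodaira type `IV` or `IV*`**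
(read in `ℚ_q`/`ℤ_q`, the currency of `ShadowSeed.IsShadowPrimeAt`): `f_v = ε_v = 2` at an additive
place of residue characteristic `≥ 5` (`conductorExponent_eq_tameConductorExponent_holds`), the type at
`v` being the `ℤ_q`-type (`kodairaSymbolAt_eq_padic`).
[cite: SilvermanATAEC1994, Thm. IV.10.2 and IV.10.4 (PDF pp. 358–362), Table 4.1 (p. 365)] -/
theorem Rat.conductorExponent_eq_two_of_kodairaSymbol_padic {q : ℕ} [Fact q.Prime]
    (hv : ((primesEquiv v : Nat.Primes) : ℕ) = q) (h5 : 5 ≤ q)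
    (hK : (E.baseChange ℚ_[q]).kodairaSymbol ℤ_[q] = .IV ∨
      (E.baseChange ℚ_[q]).kodairaSymbol ℤ_[q] = .IVstar) :
    E.conductorExponent v = 2 := by
  subst hv
  have h2 : ((2 : ℕ) : 𝓞 ℚ) ∉ v.asIdeal :=
    natCast_notMem_of_primesEquiv_ne v Nat.prime_two (by omega)
  have h3 : ((3 : ℕ) : 𝓞 ℚ) ∉ v.asIdeal :=
    natCast_notMem_of_primesEquiv_ne v Nat.prime_three (by omega)
  have hk : (E.kodairaSymbolAt v).IsAdditive := by
    rw [kodairaSymbolAt_eq_padic v E]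
    rcases hK with h | h <;> rw [h] <;> decide
  rw [conductorExponent_eq_tameConductorExponent_holds v E
      (v.ringChar_ne_of_natCast_notMem (p := 2) h2)
      (v.ringChar_ne_of_natCast_notMem (p := 3) h3),
    (KodairaSymbol.tameConductorExponent_eq_two_iff _).mpr hk]

/-- **`a_v(E[3]) = 1` (`q ∥ N(ρ̄_{E,3})`) at a place of `ℚ` over a prime `q ≥ 5` of Kodaira type `IV`
or `IV*` with `3 ∣ c_q`** — the shadow primes `q ≥ 5` of line `shadow_seed` (crux
`KobayashiLowerHalfLargeImage`; there `c_q = 3` for `q ≡ 2 (mod 3)`), in the `ℚ_q`/`ℤ_q` currency of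
`ShadowSeed.IsShadowPrimeAt`: the Serre conductor exponent (`GaloisRep.artinConductorExponent`, the
exponent of `ModPGaloisRep.serreLevel`) of the `3`-torsion `E[3]` at `v` is `1`, by
`WeierstrassCurve.artinConductorExponent_torsion_three_eq_one` (p661969) through the dictionary
`kodairaSymbolAt_eq_padic` / `localTamagawaNumber_padic_eq_holds`.  With
`Rat.conductorExponent_eq_two_of_kodairaSymbol_padic`: `q² ∥ N_E` but `q ∥ N(ρ̄)` — Diamond's
level-lowered newform has `q` exactly once in its level, i.e. is Steinberg at `q`.
[cite: Serre1987, §1.2 (definition of N(ρ)) and §4] [cite: DarmonDiamondTaylor1995, Lemma 2.7 and Remark 2.14]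
[cite: SilvermanATAEC1994, Thm. IV.10.2 (PDF pp. 358–362), Table 4.1 (p. 365)] -/
theorem Rat.artinConductorExponent_torsion_three_eq_one_of_kodairaSymbol_padic {q : ℕ} [Fact q.Prime]
    (hv : ((primesEquiv v : Nat.Primes) : ℕ) = q) (h5 : 5 ≤ q)
    (hK : (E.baseChange ℚ_[q]).kodairaSymbol ℤ_[q] = .IV ∨
      (E.baseChange ℚ_[q]).kodairaSymbol ℤ_[q] = .IVstar)
    (hc : 3 ∣ (E.baseChange ℚ_[q]).localTamagawaNumber ℤ_[q]) :
    (E.torsionGaloisRep 3).artinConductorExponent v = 1 := by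
  haveI : PerfectField (IsLocalRing.ResidueField (v.adicCompletionIntegers ℚ)) :=
    PerfectField.ofFinite
  have hc' : 3 ∣ (E.baseChange (v.adicCompletion ℚ)).localTamagawaNumber
      (v.adicCompletionIntegers ℚ) := by
    rwa [localTamagawaNumber_padic_eq_holds E v q hv] at hc
  subst hv
  have h2 : ((2 : ℕ) : 𝓞 ℚ) ∉ v.asIdeal :=
    natCast_notMem_of_primesEquiv_ne v Nat.prime_two (by omega)
  have h3 : ((3 : ℕ) : 𝓞 ℚ) ∉ v.asIdeal :=
    natCast_notMem_of_primesEquiv_ne v Nat.prime_three (by omega)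
  have hk : (E.kodairaSymbolAt v).IsAdditive := by
    rw [kodairaSymbolAt_eq_padic v E]
    rcases hK with h | h <;> rw [h] <;> decide
  have hadd : E.HasAdditiveReductionAt v := (isAdditive_kodairaSymbolAt_iff_holds v E).mp hk
  exact E.artinConductorExponent_torsion_three_eq_one hadd (by exact_mod_cast h2)
    (by exact_mod_cast h3) hc'

/-- **`a_v(E[p]) = f_v(E) = 2` for `p ≥ 5` at a place of `ℚ` over an additive prime `q ∉ {2, 3, p}`**
(additivity read on the `ℤ_q`-Kodaira type, `kodairaSymbolAt_eq_padic`): no conductor drop at `p ≥ 5`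
(`WeierstrassCurve.artinConductorExponent_torsion_eq_conductorExponent_of_five_le`, p661969).
[cite: Serre1987, §1.2 (definition of N(ρ)) and §4.1] [cite: SilvermanATAEC1994, Thm. IV.10.2 and IV.10.4 (PDF pp. 358–362)] -/
theorem Rat.artinConductorExponent_torsion_eq_two_of_isAdditive_padic {q : ℕ} [Fact q.Prime]
    (hv : ((primesEquiv v : Nat.Primes) : ℕ) = q) (hq2 : q ≠ 2) (hq3 : q ≠ 3)
    {p : ℕ} [Fact p.Prime] (h5 : 5 ≤ p) (hqp : q ≠ p)
    (hK : ((E.baseChange ℚ_[q]).kodairaSymbol ℤ_[q]).IsAdditive) :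
    (E.torsionGaloisRep p).artinConductorExponent v = 2 ∧ E.conductorExponent v = 2 := by
  haveI : PerfectField (IsLocalRing.ResidueField (v.adicCompletionIntegers ℚ)) :=
    PerfectField.ofFinite
  subst hv
  have h2 : ((2 : ℕ) : 𝓞 ℚ) ∉ v.asIdeal := natCast_notMem_of_primesEquiv_ne v Nat.prime_two hq2
  have h3 : ((3 : ℕ) : 𝓞 ℚ) ∉ v.asIdeal := natCast_notMem_of_primesEquiv_ne v Nat.prime_three hq3
  have hp : ((p : ℕ) : 𝓞 ℚ) ∉ v.asIdeal := natCast_notMem_of_primesEquiv_ne v Fact.out hqp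
  have hk : (E.kodairaSymbolAt v).IsAdditive := by rwa [kodairaSymbolAt_eq_padic v E]
  have hadd : E.HasAdditiveReductionAt v := (isAdditive_kodairaSymbolAt_iff_holds v E).mp hk
  have ha := E.artinConductorExponent_torsion_eq_two_of_five_le hadd h5 hp (by exact_mod_cast h2)
    (by exact_mod_cast h3)
  have hf := E.artinConductorExponent_torsion_eq_conductorExponent_of_five_le hadd h5 hp
    (by exact_mod_cast h2) (by exact_mod_cast h3)
  exact ⟨ha, by rw [← hf, ha]⟩

end Rat

end Summit.BirchSwinnertonDyer.BirchSwinnertonDyer.Theorems.ShadowConductor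

end
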